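import Summits.Ventures.PercRepro.RankLevelSetRuleQFullUniform
import Summits.Ventures.PercRepro.RankLevelSetRuleQProdFlat
import Summits.Ventures.PercRepro.RankLevelSetRuleQThreeTerm

/-!
# PercRepro — THE LADDER OF §11 COLLAPSES INTO THE UNIFORM THEOREM (p4, gen 23; C-044; paper proofs/P4-CELL-THREE.md §12.7)

The hypotheses of the regime theorems of §11 — `k·m ≤ q + k` (RankLevelSetRuleQSmallFlat), the product condition
(RankLevelSetRuleQProdFlat), the two-term (RankLevelSetRuleQTwoTerm) and three-term (RankLevelSetRuleQThreeTerm) conditions —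
each give the row `J = 1` of the whole-diagonal pairing, `m·C(q+k, k) ≤ P(1)·(q+1)` (their own pairing lemmas at `J = 1`, and the
`t` top terms of the diagonal `k` are at most the whole diagonal), so each of those theorems is an instance of
`rhat_ge_phiK_of_full`: `rhat_ge_phiK_of_small_flat'`, `rhat_ge_phiK_of_prod'`, `rhat_ge_phiK_of_two'`, `rhat_ge_phiK_of_three'`
re-prove them from the uniform theorem.  No defs; axioms standard.
-/

namespace PercRepro

open Finset

/-- The top term `i = k − 1` of the diagonal `k`: `C(u+k, k−1)·m ≤ P(1)`. -/
lemma top_term_le_row_one (u m k : ℕ) (hk : 2 ≤ k) :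
    (u + k).choose (k - 1) * m ≤ ∑ i ∈ Ioo 0 k, (u + k).choose i * m.choose (k - i) := by
  have h := Finset.single_le_sum (f := fun i => (u + k).choose i * m.choose (k - i))
    (fun i _ => Nat.zero_le _) (show k - 1 ∈ Ioo 0 k by rw [Finset.mem_Ioo]; omega)
  simpa [show k - (k - 1) = 1 by omega] using h

/-- The two top terms `i = k − 1, k − 2` of the diagonal `k`. -/
lemma two_terms_le_row_one (u m k : ℕ) (hk : 3 ≤ k) :
    (u + k).choose (k - 1) * m.choose 1 + (u + k).choose (k - 2) * m.choose 2
      ≤ ∑ i ∈ Ioo 0 k, (u + k).choose i * m.choose (k - i) := by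
  have hsub : ({k - 1, k - 2} : Finset ℕ) ⊆ Ioo 0 k := by
    intro i hi
    simp only [Finset.mem_insert, Finset.mem_singleton] at hi
    rw [Finset.mem_Ioo]; omega
  refine le_trans (le_of_eq ?_) (Finset.sum_le_sum_of_subset_of_nonneg hsub (fun i _ _ => Nat.zero_le _))
  rw [Finset.sum_pair (by omega), show k - (k - 1) = 1 by omega, show k - (k - 2) = 2 by omega]

/-- The three top terms `i = k − 1, k − 2, k − 3` of the diagonal `k`. -/
lemma three_terms_le_row_one (u m k : ℕ) (hk : 4 ≤ k) :
    (u + k).choose (k - 1) * m.choose 1 + (u + k).choose (k - 2) * m.choose 2 + (u + k).choose (k - 3) * m.choose 3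
      ≤ ∑ i ∈ Ioo 0 k, (u + k).choose i * m.choose (k - i) := by
  have hsub : ({k - 1, k - 2, k - 3} : Finset ℕ) ⊆ Ioo 0 k := by
    intro i hi
    simp only [Finset.mem_insert, Finset.mem_singleton] at hi
    rw [Finset.mem_Ioo]; omega
  refine le_trans (le_of_eq ?_) (Finset.sum_le_sum_of_subset_of_nonneg hsub (fun i _ _ => Nat.zero_le _))
  rw [Finset.sum_insert (by simp only [Finset.mem_insert, Finset.mem_singleton]; omega), Finset.sum_pair (by omega),
    show k - (k - 1) = 1 by omega, show k - (k - 2) = 2 by omega, show k - (k - 3) = 3 by omega]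
  ring

/-- **SmallFlat is an instance**: `k·m ≤ q + k` gives the row `J = 1`. -/
theorem rhat_ge_phiK_of_small_flat' (q k m : ℕ) (hk : 3 ≤ k) (hu : k - 1 ≤ q - m) (hm : m ≤ q)
    (hkm : k * m ≤ q + k) : phiK (q + k) q ≤ rhat q k m := by
  refine rhat_ge_phiK_of_full q k m hk hu hm ?_
  obtain ⟨u, rfl⟩ : ∃ u, q = u + m := ⟨q - m, by omega⟩
  rw [show u + m + k - m = u + k by omega]
  have hp := pairing_choose u m 0 k (by omega) hkm
  rw [show u + m + (0 + 1) + (k - 1) = u + m + k by omega, show 0 + 1 + (k - 1) = k by omega,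
    show u + 1 + (k - 1) = u + k by omega, show u + m + (0 + 1) = u + m + 1 by omega, Nat.choose_one_right] at hp
  calc m * (u + m + k).choose k ≤ m * ((u + k).choose (k - 1) * (u + m + 1)) := Nat.mul_le_mul_left _ hp
    _ = ((u + k).choose (k - 1) * m) * (u + m + 1) := by ring
    _ ≤ (∑ i ∈ Ioo 0 k, (u + k).choose i * m.choose (k - i)) * (u + m + 1) :=
        Nat.mul_le_mul_right _ (top_term_le_row_one u m k (by omega))

/-- **ProdFlat is an instance**: the product condition gives the row `J = 1`. -/
theorem rhat_ge_phiK_of_prod' (q k m : ℕ) (hk : 3 ≤ k) (hu : k - 1 ≤ q - m) (hm : m ≤ q)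
    (hprod : ∏ i ∈ range (k - 1), (q + 2 + i) ≤ k * ∏ i ∈ range (k - 1), (q - m + 2 + i)) :
    phiK (q + k) q ≤ rhat q k m := by
  refine rhat_ge_phiK_of_full q k m hk hu hm ?_
  obtain ⟨u, rfl⟩ : ∃ u, q = u + m := ⟨q - m, by omega⟩
  rw [show u + m + k - m = u + k by omega]
  rw [Nat.add_sub_cancel] at hprod
  have hp := pairing_choose_of_prod u m 0 k (by omega) hprod
  rw [show u + m + (0 + 1) + (k - 1) = u + m + k by omega, show 0 + 1 + (k - 1) = k by omega,
    show u + 1 + (k - 1) = u + k by omega, show u + m + (0 + 1) = u + m + 1 by omega, Nat.choose_one_right] at hp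
  calc m * (u + m + k).choose k ≤ m * ((u + k).choose (k - 1) * (u + m + 1)) := Nat.mul_le_mul_left _ hp
    _ = ((u + k).choose (k - 1) * m) * (u + m + 1) := by ring
    _ ≤ (∑ i ∈ Ioo 0 k, (u + k).choose i * m.choose (k - i)) * (u + m + 1) :=
        Nat.mul_le_mul_right _ (top_term_le_row_one u m k (by omega))

/-- **TwoTerm is an instance**: the two-term condition gives the row `J = 1`. -/
theorem rhat_ge_phiK_of_two' (q k m : ℕ) (hk : 3 ≤ k) (hu : k - 1 ≤ q - m) (hm : m ≤ q)
    (h2 : 2 * (q - m + 2) * ∏ i ∈ range (k - 1), (q + 2 + i)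
        ≤ ((q - m + 2) * 2 + (k - 1) * (m - 1)) * k * ∏ i ∈ range (k - 1), (q - m + 2 + i)) :
    phiK (q + k) q ≤ rhat q k m := by
  refine rhat_ge_phiK_of_full q k m hk hu hm ?_
  obtain ⟨u, rfl⟩ : ∃ u, q = u + m := ⟨q - m, by omega⟩
  rw [show u + m + k - m = u + k by omega]
  rw [Nat.add_sub_cancel] at h2 hu
  rcases Nat.eq_zero_or_pos m with h0 | hpos
  · subst h0; simp
  have hp := pairing_choose_two u m 1 k hk hu le_rfl hpos h2
  rw [show u + m + 1 + (k - 1) = u + m + k by omega, show 1 + (k - 1) = k by omega, Nat.choose_one_right (u + m + 1),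
    show (1 : ℕ) + 1 = 2 by rfl] at hp
  calc m * (u + m + k).choose k = m.choose 1 * (u + m + k).choose k := by rw [Nat.choose_one_right]
    _ ≤ ((u + k).choose (k - 1) * m.choose 1 + (u + k).choose (k - 2) * m.choose 2) * (u + m + 1) := hp
    _ ≤ (∑ i ∈ Ioo 0 k, (u + k).choose i * m.choose (k - i)) * (u + m + 1) :=
        Nat.mul_le_mul_right _ (two_terms_le_row_one u m k hk)

/-- **ThreeTerm is an instance**: the three-term condition gives the row `J = 1`. -/
theorem rhat_ge_phiK_of_three' (q k m : ℕ) (hk : 4 ≤ k) (hu : k - 1 ≤ q - m) (hm : m ≤ q)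
    (h3 : 6 * (q - m + 2) * (q - m + 3) * ∏ i ∈ range (k - 1), (q + 2 + i)
        ≤ (6 * (q - m + 2) * (q - m + 3) + 3 * (k - 1) * (q - m + 3) * (m - 1) + (k - 1) * (k - 2) * (m - 1) * (m - 2)) * k
            * ∏ i ∈ range (k - 1), (q - m + 2 + i)) :
    phiK (q + k) q ≤ rhat q k m := by
  refine rhat_ge_phiK_of_full q k m (by omega) hu hm ?_
  obtain ⟨u, rfl⟩ : ∃ u, q = u + m := ⟨q - m, by omega⟩
  rw [show u + m + k - m = u + k by omega]
  rw [Nat.add_sub_cancel] at h3 hu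
  rcases Nat.eq_zero_or_pos m with h0 | hpos
  · subst h0; simp
  have hp := pairing_choose_three u m 1 k hk hu le_rfl hpos h3
  rw [show u + m + 1 + (k - 1) = u + m + k by omega, show 1 + (k - 1) = k by omega, Nat.choose_one_right (u + m + 1),
    show (1 : ℕ) + 1 = 2 by rfl, show (1 : ℕ) + 2 = 3 by rfl] at hp
  calc m * (u + m + k).choose k = m.choose 1 * (u + m + k).choose k := by rw [Nat.choose_one_right]
    _ ≤ ((u + k).choose (k - 1) * m.choose 1 + (u + k).choose (k - 2) * m.choose 2
          + (u + k).choose (k - 3) * m.choose 3) * (u + m + 1) := hp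
    _ ≤ (∑ i ∈ Ioo 0 k, (u + k).choose i * m.choose (k - i)) * (u + m + 1) :=
        Nat.mul_le_mul_right _ (three_terms_le_row_one u m k hk)

end PercRepro
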